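import Mathlib
import Literature.Analysis.FluidPDE.AxisymmetricReflection
import Literature.Analysis.FluidPDE.KatoSymmetryCovariance
import Summits.NavierStokesRegularity.NavierStokesRegularity.Theorems.AxisymmetricExtremalityAxisymmetricKatoGlobalReduction
import Summits.NavierStokesRegularity.NavierStokesRegularity.Theorems.AxisymmetricExtremalityAxisymmetricKatoGlobalStubSereginLogSwirlOrigin
import HarnessLib.Audit
import HarnessLib

/-!
# L3TimeExponentPincer — swirl-free axisymmetric `L³` data have global Kato solutions (`T_max = ∞`)

Support kernel for the crux `L3CascadeJaw` (item stmt-NavierStokesRegularity-19499) of route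
`L3TimeExponentPincer`: the core of the node `(SFL³-mild)` of planner nsreg-p2's ROUND-12
Addendum A §A.1 (`…Theorems.L3TimeExponentPincerSFL3.SFL3Mild`), in the pointwise-symmetric,
origin-axis form.  **For a weakly divergence-free `u₀ ∈ L³(ℝ³; ℝ³)` which is axisymmetric
(`IsAxisymmetric`) and swirl-free (`HasNoSwirl`), the Kato solution is global**
(`HasGlobalKatoSolution 1 u₀`).

The memo planned a local argument (η-maximum principle from a positive time + Jia–Šverák's
Lemma 7 + local energy + div–curl).  The tree ALREADY holds a complete Kato-class regularity
machinery for the harder axisymmetric-WITH-swirl crux `AxisymmetricKatoGlobal`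
(stmt-NavierStokesRegularity-15453, line `registered`, all bookkeeping stubs landed):
`stub_katoAxisymSingularPoint` (no global Kato solution ⇒ a finite-time Kato solution, smooth and
axisymmetric on the open strip, with a singular point; Lemarié-Rieusset 2016 Thm. 15.1 (C)),
`logSwirlRegularity_of_seregin2022` (an axisymmetric Kato solution whose swirl `Γ = r u_θ` has the
logarithmic modulus `|Γ| ≤ C/|log r|³` at the axis up to the final time is bounded near every
point of the final slice: Seregin's backward ε-regularity off the axis, Seregin 2022 §2 on the
axis) and the DISCHARGED local criterion `seregin2022_logSwirl_regularAtOrigin_holds`.  In the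
swirl-free class the swirl vanishes identically, so the modulus hypothesis holds with `C = 0`; the
only new input is that **the swirl-free property propagates along the Kato solution**
(`hasNoSwirl_of_kato_of_continuous`: reflection covariance of Kato's class under the meridian
reflection `reflY`, `isKatoSolutionOn_conj_linearIsometryEquiv` + uniqueness `kato_unique_holds`,
and `IsAxisymmetric.hasNoSwirl_of_conj_reflY_eq`; Majda–Bertozzi 2002 §2.3.3).

* `hasNoSwirl_of_kato_of_continuous` — continuous axisymmetric slices of a Kato solution from an
  axisymmetric swirl-free datum are swirl-free;
* `hasGlobalKatoSolution_of_isAxisymmetric_hasNoSwirl` — **`T_max(u₀) = ∞` for swirl-free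
  axisymmetric weakly divergence-free `u₀ ∈ L³`**;
* `IsKatoSolutionOn.congr_datum_ae`, `HasGlobalKatoSolution.congr_datum_ae` — Kato's class only
  sees the datum up to a null set (change the time-zero slice), so the theorem applies to any
  a.e.-representative (used with the symmetrised representative of an a.e.-symmetric datum).

WHAT THIS IS NOT: not NS regularity (data WITH swirl — hard cores 15453 / 1964 — untouched): the
swirl-free class is classically regular for finite-energy data (Ladyzhenskaya 1968,
Ukhovskii–Yudovich 1968; tree `axisymmetric_no_swirl_global_regularity_holds`); this is its
critical `L³`-datum / Kato-class form, assembled from proved tree theorems; the crux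
`L3CascadeJaw` is untouched; no crux claim.
-/

noncomputable section

open Set MeasureTheory Filter Topology Function Metric TopologicalSpace
open scoped ENNReal NNReal
open Literature.Analysis.FluidPDE Literature.Analysis.FunctionSpaces

namespace Summit.NavierStokesRegularity.NavierStokesRegularity.Theorems.L3TimeExponentPincerNoSwirlKatoGlobal

open Summit.NavierStokesRegularity.NavierStokesRegularity.Theorems.AxisymmetricKatoGlobal.Registered
open Summit.NavierStokesRegularity.NavierStokesRegularity.Theorems.AxisymmetricKatoGlobal.EulerScaling

/-! ### The swirl-free property propagates along a Kato solution -/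

/-- A slice of a field jointly continuous on the open strip `(0, T) × ℝ³` is continuous. -/
theorem continuous_slice_of_contDiffOn {T : ℝ}
    {u : ℝ → EuclideanSpace ℝ (Fin 3) → EuclideanSpace ℝ (Fin 3)}
    (hsm : ContDiffOn ℝ (⊤ : ℕ∞) (uncurry u) (Ioo 0 T ×ˢ univ)) {t : ℝ} (ht : t ∈ Ioo 0 T) :
    Continuous (u t) := by
  have h2 : Continuous fun x : EuclideanSpace ℝ (Fin 3) => ((t, x) : ℝ × EuclideanSpace ℝ (Fin 3)) := by
    fun_prop
  exact hsm.continuousOn.comp_continuous h2 fun x => ⟨ht, mem_univ _⟩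

/-- **Swirl-freeness propagates along a Kato solution** (reflection covariance + uniqueness):
if `u` is a Kato solution on `[0, T)` (`ν > 0`) from an axisymmetric swirl-free datum `u₀`, and the
slice `u t` (`0 ≤ t < T`) is continuous and axisymmetric, then `u t` is swirl-free.  Indeed the
datum is fixed by conjugation with the meridian reflection `σ = reflY`
(`IsAxisymmetric.conj_reflY_eq`), so `u t = σ ∘ u t ∘ σ` a.e. (`katoSolution_ae_eq_conj_of_datum`),
hence everywhere by continuity, and an axisymmetric `σ`-equivariant field has no swirl
(`IsAxisymmetric.hasNoSwirl_of_conj_reflY_eq`). -/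
theorem hasNoSwirl_of_kato_of_continuous {ν T : ℝ} (hν : 0 < ν)
    {u₀ : EuclideanSpace ℝ (Fin 3) → EuclideanSpace ℝ (Fin 3)}
    {u : ℝ → EuclideanSpace ℝ (Fin 3) → EuclideanSpace ℝ (Fin 3)}
    (hK : IsKatoSolutionOn T ν u₀ u) (hax : IsAxisymmetric u₀) (hsw : HasNoSwirl u₀)
    {t : ℝ} (ht : t ∈ Ico 0 T) (hcont : Continuous (u t)) (haxt : IsAxisymmetric (u t)) :
    HasNoSwirl (u t) := by
  have hdat : (fun x => reflY (u₀ (reflY.symm x))) = u₀ := funext fun x => hax.conj_reflY_eq hsw x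
  have h1 : u t =ᵐ[volume] fun x => reflY (u t (reflY.symm x)) :=
    katoSolution_ae_eq_conj_of_datum reflY hν hK hdat ht
  have hc : Continuous fun x => reflY (u t (reflY.symm x)) :=
    reflY.continuous.comp (hcont.comp reflY.symm.continuous)
  have heq : u t = fun x => reflY (u t (reflY.symm x)) := (Continuous.ae_eq_iff_eq volume hcont hc).1 h1
  exact haxt.hasNoSwirl_of_conj_reflY_eq fun x => (congrFun heq x).symm

/-! ### `T_max = ∞` in the swirl-free axisymmetric class -/

/-- **Swirl-free axisymmetric `L³` data have global Kato solutions.**  Let `u₀ ∈ L³(ℝ³; ℝ³)` be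
weakly divergence free, axisymmetric about the `x₂`-axis and swirl-free.  Then
`HasGlobalKatoSolution 1 u₀` (`T_max(u₀) = ∞`).  Proof: otherwise
`stub_katoAxisymSingularPoint` gives a Kato solution `u` on `[0, T)`, smooth with axisymmetric
slices on `(0, T) × ℝ³`, singular at `(T, x_*)`; its slices are swirl-free
(`hasNoSwirl_of_kato_of_continuous`), so the logarithmic axis modulus of the swirl holds with
constant `0`, and `logSwirlRegularity_of_seregin2022` (fed with the proved
`seregin2022_logSwirl_regularAtOrigin_holds`) bounds `u` near `(T, x_*)` — contradiction. -/
theorem hasGlobalKatoSolution_of_isAxisymmetric_hasNoSwirl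
    {u₀ : EuclideanSpace ℝ (Fin 3) → EuclideanSpace ℝ (Fin 3)} (hu₀ : MemLp u₀ 3 volume)
    (hdiv : IsWeaklyDivFree u₀) (hax : IsAxisymmetric u₀) (hsw : HasNoSwirl u₀) :
    HasGlobalKatoSolution 1 u₀ := by
  by_contra hng
  obtain ⟨T, hT, xs, u, hK, hsm, haxi, hsing⟩ :=
    stub_katoAxisymSingularPoint 1 one_pos u₀ hu₀ hdiv hax hng
  -- the slices are swirl-free
  have hns : ∀ t ∈ Ioo 0 T, HasNoSwirl (u t) := fun t ht =>
    hasNoSwirl_of_kato_of_continuous one_pos hK hax hsw ⟨ht.1.le, ht.2⟩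
      (continuous_slice_of_contDiffOn hsm ht) (haxi t ht)
  -- the logarithmic modulus of the (vanishing) swirl, with constant `0`
  have ht₀ : T / 2 ∈ Ioo 0 T := ⟨by linarith, by linarith⟩
  have hmod : ∃ t₀ ∈ Ioo 0 T, ∃ C δ₀ : ℝ, 0 < δ₀ ∧ δ₀ < 1 ∧
      ∀ t ∈ Ico t₀ T, ∀ x : EuclideanSpace ℝ (Fin 3), cylRadius x ≤ δ₀ →
        |swirl (u t) x| ≤ C / |Real.log (cylRadius x)| ^ 3 := by
    refine ⟨T / 2, ht₀, 0, 1 / 2, by norm_num, by norm_num, fun t ht x _ => ?_⟩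
    rw [hns t ⟨ht₀.1.trans_le ht.1, ht.2⟩ x, abs_zero, zero_div]
  obtain ⟨r, hr, K, hbd⟩ := logSwirlRegularity_of_seregin2022
    seregin2022_logSwirl_regularAtOrigin_holds one_pos hT hK hsm haxi hmod xs
  exact absurd (hsing r hr) (eLpNorm_parabolicCylinder_lt_top_of_forall_le hbd).ne

/-! ### Kato's class only sees the datum up to a null set -/

/-- **Change of datum on a null set.**  If `u` is a Kato solution on `[0, T)` from `u₀` and
`u₀' = u₀` a.e., then the field with the time-zero slice replaced by `u₀'` is a Kato solution on
`[0, T)` from `u₀'` (the duality identity, the class `C([0,T); L³)` and the measurability on the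
open strip see the slices only up to null sets / away from `t = 0`). -/
theorem _root_.Literature.Analysis.FluidPDE.IsKatoSolutionOn.congr_datum_ae {T ν : ℝ}
    {u₀ u₀' : EuclideanSpace ℝ (Fin 3) → EuclideanSpace ℝ (Fin 3)}
    {u : ℝ → EuclideanSpace ℝ (Fin 3) → EuclideanSpace ℝ (Fin 3)}
    (h : IsKatoSolutionOn T ν u₀ u) (hae : u₀' =ᵐ[volume] u₀) :
    IsKatoSolutionOn T ν u₀' (Function.update u 0 u₀') := by
  have hslice : ∀ t ∈ Ico 0 T, Function.update u 0 u₀' t =ᵐ[volume] u t := by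
    intro t _
    by_cases ht0 : t = 0
    · subst ht0
      rw [Function.update_self, h.initial]
      exact hae
    · rw [Function.update_of_ne ht0]
  refine ⟨h.mild.congr_ae_Ico hslice hae, h.continuousInLpOn.congr_ae_slices hslice,
    Function.update_self _ _ _, ?_⟩
  refine h.aestronglyMeasurable.congr ?_
  filter_upwards [ae_restrict_mem (measurableSet_Ioo.prod MeasurableSet.univ)] with z hz
  have hz0 : z.1 ≠ 0 := ne_of_gt hz.1.1
  simp only [uncurry, Function.update_of_ne hz0]

/-- **`T_max = ∞` only depends on the a.e. class of the datum**: if `u₀` has a global Kato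
solution (`ν > 0`) and `u₀' = u₀` a.e., then so does `u₀'` (restrict to every `[0, n)`, change the
datum, `IsKatoSolutionOn.ofReal_le_katoMaximalTime`, `hasGlobalKatoSolution_of_katoMaximalTime_eq_top`
with the proved `kato_unique_holds`). -/
theorem _root_.Literature.Analysis.FluidPDE.HasGlobalKatoSolution.congr_datum_ae {ν : ℝ} (hν : 0 < ν)
    {u₀ u₀' : EuclideanSpace ℝ (Fin 3) → EuclideanSpace ℝ (Fin 3)}
    (h : HasGlobalKatoSolution ν u₀) (hae : u₀' =ᵐ[volume] u₀) : HasGlobalKatoSolution ν u₀' := by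
  refine hasGlobalKatoSolution_of_katoMaximalTime_eq_top kato_unique_holds hν ?_
  refine ENNReal.eq_top_of_forall_nnreal_le fun r => ?_
  obtain ⟨u, hu⟩ := h.exists_isKatoSolutionOn (r : ℝ)
  have h1 := (hu.congr_datum_ae hae).ofReal_le_katoMaximalTime
  rwa [ENNReal.ofReal_coe_nnreal] at h1

/-- **`T_max = ∞` for every a.e.-representative of a swirl-free axisymmetric `L³` datum**: if
`u₀ ∈ L³` is weakly divergence free and agrees a.e. with an axisymmetric swirl-free field, then
`HasGlobalKatoSolution 1 u₀`. -/
theorem hasGlobalKatoSolution_of_ae_eq_isAxisymmetric_hasNoSwirl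
    {u₀ w : EuclideanSpace ℝ (Fin 3) → EuclideanSpace ℝ (Fin 3)} (hu₀ : MemLp u₀ 3 volume)
    (hdiv : IsWeaklyDivFree u₀) (hw : w =ᵐ[volume] u₀) (hax : IsAxisymmetric w)
    (hsw : HasNoSwirl w) : HasGlobalKatoSolution 1 u₀ :=
  (hasGlobalKatoSolution_of_isAxisymmetric_hasNoSwirl (hu₀.ae_eq hw.symm) (hdiv.congr_ae hw.symm)
    hax hsw).congr_datum_ae one_pos hw.symm

end Summit.NavierStokesRegularity.NavierStokesRegularity.Theorems.L3TimeExponentPincerNoSwirlKatoGlobal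

end
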